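import Summits.Ventures.YMGap.RobustBall.CentreBlindSAWRate
import Summits.Ventures.YMGap.RobustBall.CentreProjectionEvenDomination
import Literature.Probability.RandomPlanarGeometry.SAWCountExplicitBounds
import Literature.ComputerArithmetic.DeDinechinLauterMullerTorres2013.TinyArguments
import HarnessLib

/-!
# RobustBall/CentreBlindSAWRateEven — the SAW-rate rows of the `β`-ladder for `SU(N)`, `N` EVEN: `AreaLawCentreBlind N (n+1) β` with the explicit bound
# `|⟨W_{R×T}⟩| ≤ (A r^T/(1−r))^R`, `r = λ·tanh(N|β|)`, from any certificate `c_ℓ(ℤⁿ) ≤ A λ^ℓ`; UNCONDITIONALLY `d = 4` up to `4.76·tanh(N|β|) < 1`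
# (`SU(4)`: `|β| < 0.05331…`) and `d = 3` up to `2.688·tanh(N|β|) < 1` (`SU(4)`: `|β| < 0.09765…`)

HONEST FRAMING: venture file of the cell `pub-ymgap` (QuantumFields programme), track Y2 ROBUST-BALL / DS seat ds-4 (g13).  WHAT THIS IS: Mack–Petkova
domination for even `N` (`CentreProjectionEvenDomination`: `|⟨(1/N) Re tr U_{∂R×T}⟩_{β,W,L}| ≤ z2Loop (N|β|)`, the Wilson loop of `ℤ₂` lattice gauge theory
at `β₂ = N|β|`) composed with the SAW-rate bound of the `SU(2)` chain READ AT THE TRIVIAL BACKGROUND (`CentreBlindSAWRate`: `z2Loop β_W ≤ (A r^T/(1−r))^{#sel}`,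
`r = λ·tanh β_W`, for every counting certificate `c_ℓ(ℤⁿ) ≤ A λ^ℓ` of the self-avoiding walks of `ℤⁿ` — Fisher's inequality on the layers plus the lift of
layer paths to self-avoiding walks).  RESULTS: `z2Loop_le_sawRate`; **`suN_even_areaLawCentreBlind_sawRate : Even N → 1 ≤ n → 1 ≤ A → (∀ ℓ, c_ℓ(ℤⁿ) ≤ A λ^ℓ)
→ λ·tanh(N|β|) < 1 → AreaLawCentreBlind N (n+1) β`** with ONE explicit `(C, c) = (A/(1−r) + 1, −log max(r, 1/2))`; rows `(2n−1)·tanh(N|β|) < 1` (no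
immediate reversals) and ★ **`suN_even_areaLawCentreBlind_sawRate_dim4_memTen : Even N → 4.76·tanh(N|β|) < 1 → AreaLawCentreBlind N 4 β`** (UNCONDITIONAL,
kernel-checked Pönitz–Tittmann memory-10 certificate, Literature `SAWCountExplicitBounds`), `SU(4)` `d = 4`: `|β| < artanh(1/4.76)/4 = 0.053315…` (rung 1 of
`CentreBlindAreaLaw` gave `1/24 = 0.0417`), cell `AreaLawCentreBlind 4 4 (1/20)` with its string-tension reading; `d = 3`:
`suN_even_areaLawCentreBlind_sawRate_dim3_memEighteen : Even N → 2.688·tanh(N|β|) < 1 → AreaLawCentreBlind N 3 β` (memory-18 certificate of `ℤ²`).  HONEST LABEL: `N` EVEN only (for odd `N`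
the induced `ℤ_N` couplings are complex and no comparison inequality is available); strong-coupling lattice statements on finite tori uniformly in `L`;
the `d = 4` / `d = 3` numbers rest on `native_decide` evaluations (computational, inherited from `SAWFiniteMemoryZ3K10` / `SAWFiniteMemory18At2688`); ceiling of the
route `N|β| < artanh(1/μ(ℤⁿ))` (`≈ 0.2168` for `d = 4`); nothing continuum / spectral / Clay.

References AS PRINTED: G. Mack, V. B. Petkova, Ann. Phys. 123 (1979) 442, §2; M. E. Fisher, Phys. Rev. 162 (1967) 480; A. Pönitz, P. Tittmann, Electron.
J. Combin. 7 (2000) R21, Table 2.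
-/

noncomputable section

open Finset
open Literature.MathematicalPhysics.QuantumLattice (fundamentalRep)
open Literature.MathematicalPhysics.QuantumFieldTheory
open Literature.Probability.RandomPlanarGeometry.SAW.Zd (count count_three_le_pow_476 count_two_le_pow_2688)

namespace Summit.Ventures.YMGap.RobustBall

open ZN ZNFluxW ZTwo

variable {n L N : ℕ} [NeZero L]

/-! ### No defect: the windowed `ℤ_N` loop is the plain induced loop -/

/-- With an empty defect family the windowed weight `znWD (gS β gD U)` is `CentreProjection`'s `znWeight β U`. [folklore] -/
theorem znWD_gS_fin_zero {d : ℕ} [NeZero N] (β : ℝ) (gD : Fin 0 → (Plaquette d L → ZMod N) → GaugeConfig d L (SUN N) → ℝ)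
    (U : GaugeConfig d L (SUN N)) (k : Edge d L → ZMod N) : ZNFluxW.znWD (gS β gD U) k = znWeight β U k := by
  unfold ZNFluxW.znWD znWeight twistEnergy
  congr 1
  rw [Fintype.sum_sum_type, Finset.univ_eq_empty (α := Fin 0), Finset.sum_empty, add_zero, Finset.mul_sum]
  rfl

/-- With an empty defect family `znLoopW = znLoop`. [folklore] -/
theorem znLoopW_fin_zero {d : ℕ} [NeZero N] (β : ℝ) (gD : Fin 0 → (Plaquette d L → ZMod N) → GaugeConfig d L (SUN N) → ℝ)
    (U : GaugeConfig d L (SUN N)) (x : Site d L) (i j : Fin d) (R T : ℕ) : znLoopW β gD U x i j R T = znLoop β U x i j R T := by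
  unfold znLoopW znLoop
  have : ZNFluxW.znWD (gS β gD U) = znWeight β U := funext (znWD_gS_fin_zero β gD U)
  rw [this]

/-! ### The `ℤ₂` lattice gauge theory loop obeys the SAW-rate bound -/

/-- **`z2Loop βW ≤ (A r^T/(1−r))^{#selIdx 1 R'}`**, `r = λ·tanh βW` (`L ≥ 3`, `n ≥ 1`, `i ≠ j`, `2R', 2T ≤ L`, `βW ≥ 0`, certificate `c_ℓ(ℤⁿ) ≤ A λ^ℓ`,
`A ≥ 1`): the SAW-rate bound of the `SU(2)` chain at the trivial background. [cite: Fisher1967, Phys. Rev. 162 (1967) 480] -/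
theorem z2Loop_le_sawRate (hn : 1 ≤ n) (hL : 3 ≤ L) {βW A lam : ℝ} (hβ : 0 ≤ βW) (hA : 1 ≤ A) (hlam : 0 ≤ lam)
    (hcount : ∀ ℓ, (count n ℓ : ℝ) ≤ A * lam ^ ℓ) (hr : lam * Real.tanh βW < 1) (x : Site (n + 1) L) {i j : Fin (n + 1)} (hij : i ≠ j)
    {R' T : ℕ} (hR : 2 * R' ≤ L) (hT : 2 * T ≤ L) :
    ZTwo.z2Loop βW x i j R' T ≤ (A * (lam * Real.tanh βW) ^ T / (1 - lam * Real.tanh βW)) ^ (selIdx 1 R').card := by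
  have e2 : 2 * |βW / 2| = βW := by rw [abs_of_nonneg (by linarith)]; ring
  have h := norm_znLoopW_le_sawRate hn hL (β := βW / 2) hA hlam hcount (by rw [e2]; exact hr) (fun (_ : Fin 0) _ _ => (0 : ℝ))
    (1 : GaugeConfig (n + 1) L (SUN 2)) x hij hR hT
  rw [znLoopW_fin_zero, e2] at h
  have e : ZTwo.z2Loop βW x i j R' T = (znLoop (βW / 2) (1 : GaugeConfig (n + 1) L (SUN 2)) x i j R' T).re := by
    rw [← ZTwo.z2Loop_eq_re_znLoop_one]; ring_nf
  rw [e]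
  exact (Complex.re_le_norm _).trans h

/-- **Even `N`: centre projection + SAW-rate bound** (`L ≥ 3`, `n ≥ 1`): for every twist-blind `W` and every non-wrapping `R' × T` loop,
`|⟨(1/N) tr U_{R'×T}⟩_{β,W,L}| ≤ (A r^T/(1−r))^{#selIdx 1 R'}`, `r = λ·tanh(N|β|)`. [cite: MackPetkova1979, §2] -/
theorem abs_wilsonLoop_le_sawRate_even [NeZero N] (hN : Even N) (hn : 1 ≤ n) (hL : 3 ≤ L) {β A lam : ℝ} (hA : 1 ≤ A) (hlam : 0 ≤ lam)
    (hcount : ∀ ℓ, (count n ℓ : ℝ) ≤ A * lam ^ ℓ) (hr : lam * Real.tanh ((N : ℝ) * |β|) < 1) (W : Perturbation (n + 1) L N) (hW : IsTwistBlind W)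
    (x : Site (n + 1) L) {i j : Fin (n + 1)} (hij : i ≠ j) {R' T : ℕ} (hR : 2 * R' ≤ L) (hT : 2 * T ≤ L) :
    |W.expectation (fundamentalRep (Fin N)) β (wilsonLoop (fundamentalRep (Fin N)) x i j R' T)| ≤
      (A * (lam * Real.tanh ((N : ℝ) * |β|)) ^ T / (1 - lam * Real.tanh ((N : ℝ) * |β|))) ^ (selIdx 1 R').card :=
  suN_even_abs_wilsonLoop_le_of_z2Loop_le hN (z2Loop_le_sawRate hn hL (by positivity) hA hlam hcount hr x hij hR hT) W hW

/-- The same in the form `|⟨W_{R'×T}⟩| ≤ (K · r^T)^{R'}`, `K = A/(1−r)`, `r = λ·tanh(N|β|)`. [folklore] -/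
theorem abs_wilsonLoop_le_sawRate_even_pow [NeZero N] (hN : Even N) (hn : 1 ≤ n) (hL : 3 ≤ L) {β A lam : ℝ} (hA : 1 ≤ A) (hlam : 0 ≤ lam)
    (hcount : ∀ ℓ, (count n ℓ : ℝ) ≤ A * lam ^ ℓ) (hr : lam * Real.tanh ((N : ℝ) * |β|) < 1) (W : Perturbation (n + 1) L N) (hW : IsTwistBlind W)
    (x : Site (n + 1) L) {i j : Fin (n + 1)} (hij : i ≠ j) {R' T : ℕ} (hR : 2 * R' ≤ L) (hT : 2 * T ≤ L) :
    |W.expectation (fundamentalRep (Fin N)) β (wilsonLoop (fundamentalRep (Fin N)) x i j R' T)| ≤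
      (A / (1 - lam * Real.tanh ((N : ℝ) * |β|)) * (lam * Real.tanh ((N : ℝ) * |β|)) ^ T) ^ R' := by
  have ht0 : 0 ≤ Real.tanh ((N : ℝ) * |β|) := by
    rw [Real.tanh_eq_sinh_div_cosh]
    exact div_nonneg (Real.sinh_nonneg_iff.2 (by positivity)) (Real.cosh_pos _).le
  set r := lam * Real.tanh ((N : ℝ) * |β|) with hrdef
  have hr0 : 0 ≤ r := mul_nonneg hlam ht0
  have h1r : 0 < 1 - r := by linarith
  set K := A / (1 - r) with hK
  have hK0 : 0 ≤ K := div_nonneg (by linarith) h1r.le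
  have hbound := abs_wilsonLoop_le_sawRate_even hN hn hL hA hlam hcount hr W hW x hij hR hT
  have hKr : A * r ^ T / (1 - r) = K * r ^ T := by rw [hK]; ring
  rw [hKr] at hbound
  have hF0 : 0 ≤ K * r ^ T := mul_nonneg hK0 (pow_nonneg hr0 _)
  rcases le_or_gt (K * r ^ T) 1 with hle | hgt
  · exact hbound.trans (pow_le_pow_of_le_one hF0 hle (by simpa using le_mul_card_selIdx Nat.one_pos R'))
  · exact (abs_expectation_wilsonLoop_le_one W β x i j R' T).trans (one_le_pow₀ hgt.le)

/-! ### The door and the rows for even `N` -/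

/-- **THE SAW-RATE DOOR FOR EVEN `N`: `c_ℓ(ℤⁿ) ≤ A λ^ℓ` (`A ≥ 1`), `λ·tanh(N|β|) < 1` ⇒ `AreaLawCentreBlind N (n+1) β`** (`n ≥ 1`), with ONE explicit pair
`c = −log max(r, 1/2)`, `C = A/(1−r) + 1`, `r = λ·tanh(N|β|)`. [cite: MackPetkova1979, §2] -/
theorem suN_even_areaLawCentreBlind_sawRate [NeZero N] (hN : Even N) (hn : 1 ≤ n) {β A lam : ℝ} (hA : 1 ≤ A) (hlam : 0 ≤ lam)
    (hcount : ∀ ℓ, (count n ℓ : ℝ) ≤ A * lam ^ ℓ) (hr : lam * Real.tanh ((N : ℝ) * |β|) < 1) : AreaLawCentreBlind N (n + 1) β := by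
  have ht0 : 0 ≤ Real.tanh ((N : ℝ) * |β|) := by
    rw [Real.tanh_eq_sinh_div_cosh]
    exact div_nonneg (Real.sinh_nonneg_iff.2 (by positivity)) (Real.cosh_pos _).le
  set r := lam * Real.tanh ((N : ℝ) * |β|) with hrdef
  have hr0 : 0 ≤ r := mul_nonneg hlam ht0
  have h1r : 0 < 1 - r := by linarith
  set K := A / (1 - r) with hK
  have hK1 : 1 ≤ K := by
    rw [hK, le_div_iff₀ h1r]
    linarith
  set c₀ := max r (1 / 2) with hc₀
  have hc0 : 0 < c₀ := lt_max_of_lt_right (by norm_num)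
  have hc1 : c₀ < 1 := max_lt hr (by norm_num)
  have hrc : r ≤ c₀ := le_max_left _ _
  set c := -Real.log c₀ with hc
  have hcpos : 0 < c := neg_pos.2 (Real.log_neg hc0 hc1)
  set C := K + 1 with hC
  have hC2 : 2 ≤ C := by linarith
  refine ⟨C, c, hcpos, fun L _ W hW x i j R T hij hR1 hT1 hRL hTL => ?_⟩
  have hWt : IsTwistBlind W := hW.isTwistBlind
  have hec : Real.exp (-c) = c₀ := by rw [hc, neg_neg, Real.exp_log hc0]
  by_cases hL : 3 ≤ L
  · have hstep : |W.expectation (fundamentalRep (Fin N)) β (wilsonLoop (fundamentalRep (Fin N)) x i j R T)| ≤ (K * r ^ T) ^ R :=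
      abs_wilsonLoop_le_sawRate_even_pow hN hn hL hA hlam hcount hr W hWt x hij hRL hTL
    refine hstep.trans ?_
    have h1 : (K * r ^ T) ^ R ≤ K ^ R * c₀ ^ (R * T) := by
      rw [mul_pow, ← pow_mul, mul_comm T R]
      exact mul_le_mul_of_nonneg_left (pow_le_pow_left₀ hr0 hrc _) (pow_nonneg (by linarith) _)
    have h2 : c₀ ^ (R * T) = Real.exp (-c * ((R : ℝ) * T)) := by
      rw [← hec, ← Real.exp_nat_mul]; push_cast; ring_nf
    have h3 : K ^ R ≤ C ^ (2 * (R + T)) := by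
      calc K ^ R ≤ C ^ R := pow_le_pow_left₀ (by linarith) (by linarith) _
        _ ≤ C ^ (2 * (R + T)) := pow_le_pow_right₀ (by linarith) (by omega)
    calc (K * r ^ T) ^ R ≤ K ^ R * c₀ ^ (R * T) := h1
      _ ≤ C ^ (2 * (R + T)) * c₀ ^ (R * T) := mul_le_mul_of_nonneg_right h3 (pow_nonneg hc0.le _)
      _ = C ^ (2 * (R + T)) * Real.exp (-c * ((R : ℝ) * T)) := by rw [h2]
  · have hR : R = 1 := by omega
    have hT : T = 1 := by omega
    subst hR; subst hT
    refine (abs_expectation_wilsonLoop_le_one W β x i j 1 1).trans ?_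
    have : Real.exp (-c * (((1 : ℕ) : ℝ) * ((1 : ℕ) : ℝ))) = c₀ := by simpa using hec
    rw [this]
    have hc₀ : 1 / 2 ≤ c₀ := le_max_right _ _
    have hC4 : (16 : ℝ) ≤ C ^ (2 * (1 + 1)) := by
      have := pow_le_pow_left₀ (by norm_num : (0:ℝ) ≤ 2) hC2 4
      norm_num at this ⊢
      exact this
    nlinarith

/-- **Even `N`: `(2n−1)·tanh(N|β|) < 1 ⇒ AreaLawCentreBlind N (n+1) β`** (`n ≥ 1`; walks without immediate reversals; `d = 4`: `5 tanh(N|β|) < 1`).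
[cite: Fisher1967, Phys. Rev. 162 (1967) 480 (tanh(J/kT_c) ≥ 1/(q−1))] -/
theorem suN_even_areaLawCentreBlind_sawRate_nonreversing [NeZero N] (hN : Even N) (hn : 1 ≤ n) {β : ℝ}
    (hr : (((2 * n : ℕ) : ℝ) - 1) * Real.tanh ((N : ℝ) * |β|) < 1) : AreaLawCentreBlind N (n + 1) β := by
  have h2n : (2 : ℝ) ≤ ((2 * n : ℕ) : ℝ) := by exact_mod_cast (show 2 ≤ 2 * n by omega)
  refine suN_even_areaLawCentreBlind_sawRate hN hn (A := ((2 * n : ℕ) : ℝ) / (((2 * n : ℕ) : ℝ) - 1)) ?_ (by linarith)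
    (ZTwo.count_le_nonreversing hn) hr
  rw [le_div_iff₀ (by linarith)]
  linarith

/-- ★ **Even `N`, `d = 4`, UNCONDITIONAL: `4.76·tanh(N|β|) < 1 ⇒ AreaLawCentreBlind N 4 β`** (kernel-checked certificate `c_ℓ(ℤ³) ≤ 2⁴¹·4.76^ℓ`;
`N|β| < artanh(1/4.76) = 0.21326…`; explicit `(C, c)`). [cite: PonitzTittmann2000, Table 2 (d = 3, k = 10)] -/
theorem suN_even_areaLawCentreBlind_sawRate_dim4_memTen [NeZero N] (hN : Even N) {β : ℝ} (h : 4.76 * Real.tanh ((N : ℝ) * |β|) < 1) :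
    AreaLawCentreBlind N 4 β :=
  suN_even_areaLawCentreBlind_sawRate (n := 3) hN (by norm_num) (A := 2 ^ 41) (by norm_num) (by norm_num) count_three_le_pow_476 h

/-- ★ **Even `N`, `d = 3`, UNCONDITIONAL: `2.688·tanh(N|β|) < 1 ⇒ AreaLawCentreBlind N 3 β`** (kernel-checked memory-18 certificate `c_ℓ(ℤ²) ≤ 2⁴¹·2.688^ℓ`;
`N|β| < artanh(1/2.688) = 0.39060…`; `SU(4)`: `|β| < 0.09765…`). [cite: PonitzTittmann2000, Table 2 (d = 2, k = 18)] -/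
theorem suN_even_areaLawCentreBlind_sawRate_dim3_memEighteen [NeZero N] (hN : Even N) {β : ℝ} (h : 2.688 * Real.tanh ((N : ℝ) * |β|) < 1) :
    AreaLawCentreBlind N 3 β :=
  suN_even_areaLawCentreBlind_sawRate (n := 2) hN (by norm_num) (A := 2 ^ 41) (by norm_num) (by norm_num) count_two_le_pow_2688 h

/-- **`SU(4)`, `d = 4`**: `4.76·tanh(4|β|) < 1 ⇒ AreaLawCentreBlind 4 4 β`, i.e. `|β| < 0.05331…` (rung 1 of `CentreBlindAreaLaw` gave `|β| < 1/24 =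
0.0417`). [folklore] -/
theorem su4_areaLawCentreBlind_sawRate_dim4_memTen {β : ℝ} (h : 4.76 * Real.tanh (4 * |β|) < 1) : AreaLawCentreBlind 4 4 β :=
  suN_even_areaLawCentreBlind_sawRate_dim4_memTen (N := 4) (by decide) (by exact_mod_cast h)

/-- **CELL `SU(4)`, `d = 4`, `β = 1/20`** (`4|β| = 0.2`; quintic enclosure `tanh 0.2 ≤ 0.197376`, `× 4.76 = 0.9395 < 1`): `AreaLawCentreBlind 4 4 (1/20)`.
[folklore] -/
theorem su4_areaLawCentreBlind_sawRate_dim4_cell_twentieth : AreaLawCentreBlind 4 4 (1 / 20) := by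
  refine su4_areaLawCentreBlind_sawRate_dim4_memTen ?_
  have hx : (4 * |(1 / 20 : ℝ)|) = 1 / 5 := by rw [abs_of_pos (by norm_num)]; norm_num
  rw [hx]
  have hp : Real.tanh (1 / 5 : ℝ) ≤ 1 / 5 - (1 / 5 : ℝ) ^ 3 / 3 + 2 / 15 * (1 / 5 : ℝ) ^ 5 :=
    (Literature.ComputerArithmetic.DeDinechinLauterMullerTorres2013.tanh_quintic_bounds (by norm_num) (by norm_num)).2
  have h4 : (0 : ℝ) ≤ 4.76 := by norm_num
  exact (mul_le_mul_of_nonneg_left hp h4).trans_lt (by norm_num)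

/-- **`SU(4)`, `d = 4`, `β = 1/20`, string-tension reading**: ONE `(C, c)`, `c > 0`, for every limit state of every eventually-centre-blind `SU(4)` family
(`HasAreaLawWith`, `HasAreaLawState`, `σ ≥ c` whenever `σ` exists, `IsConfining` given existence). [folklore] -/
theorem su4_stringTension_centreBlind_sawRate_dim4_cell_twentieth :
    ∃ C c : ℝ, 0 < c ∧ ∀ 𝓦 : PerturbationFamily 4 4,
      (∀ᶠ L : ℕ in Filter.atTop, IsCentreBlind (𝓦 L)) →
        ∀ μ ∈ perturbedLimitPoints (1 / 20 : ℝ) 𝓦,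
          Literature.MathematicalPhysics.QuantumLattice.HasAreaLawWith μ
              (fun g => Literature.MathematicalPhysics.QuantumLattice.normalisedCharacter 4 (fundamentalRep (Fin 4) g)) C c ∧
          Literature.MathematicalPhysics.QuantumLattice.HasAreaLawState μ
              (fun g => Literature.MathematicalPhysics.QuantumLattice.normalisedCharacter 4 (fundamentalRep (Fin 4) g)) ∧
          (∀ σ : ℝ, Literature.MathematicalPhysics.QuantumLattice.HasStringTension μ
              (fun g => Literature.MathematicalPhysics.QuantumLattice.normalisedCharacter 4 (fundamentalRep (Fin 4) g)) σ → c ≤ σ) ∧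
          ((∃ σ : ℝ, Literature.MathematicalPhysics.QuantumLattice.HasStringTension μ
              (fun g => Literature.MathematicalPhysics.QuantumLattice.normalisedCharacter 4 (fundamentalRep (Fin 4) g)) σ) →
            Literature.MathematicalPhysics.QuantumLattice.IsConfining μ
              (fun g => Literature.MathematicalPhysics.QuantumLattice.normalisedCharacter 4 (fundamentalRep (Fin 4) g))) :=
  stringTension_centreBlind (N := 4) (by norm_num) su4_areaLawCentreBlind_sawRate_dim4_cell_twentieth

end Summit.Ventures.YMGap.RobustBall

end
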